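import Summits.BirchSwinnertonDyer.BirchSwinnertonDyer.Theorems.EisensteinPrimesBSDpOnCellCTelescopeK2BigRepCofinite
import Literature.NumberTheory.EllipticCurves.PrimaryTorsionGaloisRep
import Literature.NumberTheory.EllipticCurves.TorsionCardinality
import HarnessLib

/-!
# Crux 4 `BSDpOnCellC` (stmt-BirchSwinnertonDyer-19034), line «telescope» v9, leaf N2 `stub_weightTwoControl`,
# conjunct (fg) / memo W1: the displayed input `hD` — cofinite generation of `A₂ ⊗ B^*(Ψ⁻¹)` over
# `B = ℤ_p⟦X⟧⟦T⟧` — from the leaf's clause (tor) and fibre datum (fd₀) (helper, part 2 of 2; closes nothing)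

Route `EisensteinPrimes`, crux `BSDpOnCellC`; ideator seat `bsd-idea-12` (gen 37), `--supports
stmt-BirchSwinnertonDyer-19034 --as helper`. THEOREMS only; no `def`, no instance, no named fact, no `sorry`.
HONEST FRAMING: commutative algebra and bookkeeping; proves no crux, no registered stub, no summit statement;
BSD is proved for no curve here.

WHAT AND WHY. Conjunct (fg) `Module.Finite ℤ_p⟦X⟧⟦T⟧ (XBig κ ρ₂ 𝔭bar ∅)` of the registered leaf
`stub_weightTwoControl` (`Cruxes/BSDpOnCellC/Lines/telescope.lean`, v9) rests, after
`TelescopeK2BigRepUnramified.module_finite_XBig_twoVar_of_isUnramifiedOutside` (p748872), on ONE displayed input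
`hD : IsCofinitelyGenerated ℤ_p⟦X⟧⟦T⟧ (BigRepModule ℤ_p⟦X⟧ p A₂)`, which the companion file
`…TelescopeK2BigRepCofinite` (`isCofinitelyGenerated_bigRepModule_of_isCofinitelyGenerated`) reduces to the
cofinite generation of `A₂` over `𝒪 = ℤ_p⟦X⟧ ≃ ℤ_p⟦T₁⟧`.  This file derives the latter from hypotheses the
leaf already carries — Greenberg's criterion over `ℤ_p⟦X⟧`: `A₂` is `(p, X)`-power torsion with `A₂[(p, X)]`
finite:

* the leaf's clause (tor) `∀ a, ∃ n, Xⁿ • a = 0`;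
* its fibre datum (fd₀): an additive `θ₀ : A₂[X] → P` with `θ₀ (C c • a) = c • θ₀ a` and FINITE KERNEL into a
  `p`-primary `ℤ_p`-module `P` with `P[p]` finite.  Then `A₂[X]` is `p`-power torsion (`C(p^k)·a ∈ ker θ₀`, a
  finite group, and the prime-to-`p` part of an additive order is a unit of `ℤ_p`), hence so is `A₂` by
  induction on the `X`-exponent (`exists_C_pow_smul_eq_zero_of_fd`); and
  `A₂[𝔐] ⊆ {a ∈ A₂[X] | C p • a = 0}`, which `θ₀` maps to `P[p]` with kernel inside `ker θ₀`
  (`finite_torsionBySet_maximalIdeal_of_fd`);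
* hence `hD` (`isCofinitelyGenerated_bigRepModule_twoVar_of_fd`, `B ≃ ℤ_p⟦T₁,T₂⟧` by
  `nonempty_iwasawaAlgebraTwoVar_ringEquiv_mvPowerSeries`); for `P = E[p^∞] = PrimaryTorsion E.geomPoints p`
  (`#E[p] = p²`, `WeierstrassCurve.card_torsionBy_eq_sq`; `E = W.baseChange K`, `char K = 0`) this is
  `isCofinitelyGenerated_bigRepModule_twoVar_of_fd_primaryTorsion`, whose hypotheses are conjunct (tor) and the
  clauses `θ₀ (C c • a) = c • θ₀ a`, `Finite θ₀.ker` of (fd₀) of `stub_weightTwoControl` TOKEN FOR TOKEN — so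
  (fg) ⟸ (tor) ∧ (unr) ∧ (fd₀) by name (this file → p748872 → p748332); the Galois-equivariance and
  finite-cokernel clauses of (fd₀) and the clauses (divX), (div_k), (fd_k) are not used for (fg).

References: [Greenberg2006] §3A (Props. 3.1, 3.2, pp. 358–359), §4 p. 367 ("a discrete, cofinitely generated
`Λ`-module `𝒟`"); [Greenberg2016Selmer] §1 p. 4; [SilvermanAEC2009] Cor. III.6.4(b); [Serre1968] Ch. I §1.2;
[Lang1990] Ch. 5 §1.

## References
[cite: Greenberg2006, §3 A (Props. 3.1, 3.2, pp. 358–359) and §4 p. 367 L33–39] [cite: Greenberg2016Selmer, §1 p. 4 L5–13]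
[cite: SilvermanAEC2009, Cor. III.6.4(b)] [cite: Serre1968, Ch. I §1.2] [cite: Lang1990, Ch. 5 §1]
-/

set_option linter.dupNamespace false
set_option autoImplicit false

open IsLocalRing PowerSeries
open Literature.NumberTheory.GaloisRepresentations Literature.NumberTheory.EllipticCurves
open Literature.NumberTheory.IwasawaTheory Literature.NumberTheory.IwasawaTheory.Greenberg2006
open Summit.BirchSwinnertonDyer.BirchSwinnertonDyer.Theorems.TelescopeK2BigRepCofinite

namespace Summit.BirchSwinnertonDyer.BirchSwinnertonDyer.Theorems.TelescopeK2FibreCofinite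

/-! ## §4. The K2 instance `𝒪 = ℤ_p⟦X⟧`, `B = ℤ_p⟦X⟧⟦T⟧`: the input `hD` of (fg) from (tor) and (fd₀) -/

section K2

variable {p : ℕ} [Fact p.Prime]

/-- `p` and `X` lie in the maximal ideal `(p, X)` of `ℤ_p⟦X⟧`; an element of a `ℤ_p⟦X⟧`-module killed by
`(C p)^j` and by `X^n` is killed by `(p, X)^(j+n)`. [cite: Greenberg2016Selmer, §1 p. 4 L5–10] -/
theorem iwasawaAlgebra_maximalIdeal_pow_smul_eq_zero {A : Type*} [AddCommGroup A]
    [Module (PowerSeries ℤ_[p]) A] (a : A) {j n : ℕ}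
    (hj : (C (p : ℤ_[p]) : PowerSeries ℤ_[p]) ^ j • a = 0)
    (hn : (X : PowerSeries ℤ_[p]) ^ n • a = 0) :
    ∀ r ∈ maximalIdeal (PowerSeries ℤ_[p]) ^ (j + n), r • a = 0 := by
  refine maximalIdeal_pow_add_smul_eq_zero a (fun c hc => ?_) hn
  rw [PadicInt.maximalIdeal_eq_span_p, Ideal.span_singleton_pow, Ideal.mem_span_singleton] at hc
  obtain ⟨d, rfl⟩ := hc
  rw [map_mul, map_pow, mul_comm, mul_smul, hj, smul_zero]

/-- In a `ℤ_p⟦X⟧`-module, an element of finite additive order is killed by a power of `C p`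
(the prime-to-`p` part of the order is a unit of `ℤ_p`). [cite: Lang1990, Ch. 5 §1] -/
theorem exists_C_pow_smul_eq_zero_of_nsmul_eq_zero {A : Type*} [AddCommGroup A]
    [Module (PowerSeries ℤ_[p]) A] {a : A} {N : ℕ} (hN : 0 < N) (ha : N • a = 0) :
    ∃ j : ℕ, (C (p : ℤ_[p]) : PowerSeries ℤ_[p]) ^ j • a = 0 := by
  have hp : p.Prime := Fact.out
  obtain ⟨e, N', hN', rfl⟩ := Nat.exists_eq_pow_mul_and_not_dvd hN.ne' p hp.one_lt.ne'
  have hu : IsUnit ((N' : ℤ_[p])) :=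
    PadicInt.isUnit_iff.mpr (PadicInt.norm_natCast_eq_one_iff.mpr (hp.coprime_iff_not_dvd.mpr hN'))
  obtain ⟨u, hu'⟩ := hu.map (C (R := ℤ_[p]))
  refine ⟨e, ?_⟩
  have h1 : ((p ^ e * N' : ℕ) : PowerSeries ℤ_[p]) • a = 0 := by
    rw [Nat.cast_smul_eq_nsmul]; exact ha
  rw [Nat.cast_mul, Nat.cast_pow, ← map_natCast (C (R := ℤ_[p])) p,
    ← map_natCast (C (R := ℤ_[p])) N', ← hu', mul_comm, mul_smul] at h1
  have h2 := congrArg (fun b => (↑u⁻¹ : PowerSeries ℤ_[p]) • b) h1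
  simp only [smul_zero] at h2
  rw [smul_smul, Units.inv_mul, one_smul] at h2
  exact h2

/-- **`A₂` is `p`-power torsion** from (tor) and (fd₀): on `A₂[X]` the datum `θ₀` (`θ₀(C c • a) = c • θ₀ a`,
finite kernel, `p`-primary target) gives `C(p^k)·a ∈ ker θ₀`, a finite group; induction on the `X`-exponent.
[cite: Greenberg2006, §3 A (proof of Prop. 3.1, p. 358 L19–21: `𝒟 = ⋃ 𝒟[𝔪ⁿ]`)] -/
theorem exists_C_pow_smul_eq_zero_of_fd {P : Type*} [AddCommGroup P] [Module ℤ_[p] P]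
    (hP : ∀ y : P, ∃ k : ℕ, ((p : ℤ_[p]) ^ k) • y = 0)
    {A : Type*} [AddCommGroup A] [Module (PowerSeries ℤ_[p]) A]
    (htor : ∀ a : A, ∃ n : ℕ, (X : PowerSeries ℤ_[p]) ^ n • a = 0)
    (θ₀ : Submodule.torsionBy (PowerSeries ℤ_[p]) A (X : PowerSeries ℤ_[p]) →+ P)
    (hθ : ∀ (c : ℤ_[p]) (a : Submodule.torsionBy (PowerSeries ℤ_[p]) A (X : PowerSeries ℤ_[p])),
      θ₀ (C c • a) = c • θ₀ a)
    (hker : Finite θ₀.ker) (a : A) :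
    ∃ j : ℕ, (C (p : ℤ_[p]) : PowerSeries ℤ_[p]) ^ j • a = 0 := by
  haveI := hker
  -- on `A[X]`
  have hX : ∀ b : A, (X : PowerSeries ℤ_[p]) • b = 0 →
      ∃ j : ℕ, (C (p : ℤ_[p]) : PowerSeries ℤ_[p]) ^ j • b = 0 := by
    intro b hb
    have hbmem : b ∈ Submodule.torsionBy (PowerSeries ℤ_[p]) A (X : PowerSeries ℤ_[p]) :=
      (Submodule.mem_torsionBy_iff (X : PowerSeries ℤ_[p]) b).mpr hb
    obtain ⟨k, hk⟩ := hP (θ₀ ⟨b, hbmem⟩)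
    have hmem : (C ((p : ℤ_[p]) ^ k) : PowerSeries ℤ_[p]) •
        (⟨b, hbmem⟩ : Submodule.torsionBy (PowerSeries ℤ_[p]) A (X : PowerSeries ℤ_[p])) ∈ θ₀.ker := by
      rw [AddMonoidHom.mem_ker, hθ, hk]
    obtain ⟨N, hN, hNy⟩ :=
      isOfFinAddOrder_iff_nsmul_eq_zero.mp (isOfFinAddOrder_of_finite ((⟨_, hmem⟩ : θ₀.ker)))
    have hNb : N • ((C ((p : ℤ_[p]) ^ k) : PowerSeries ℤ_[p]) • b) = 0 := by
      have h := congrArg (fun z : θ₀.ker =>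
        ((z : Submodule.torsionBy (PowerSeries ℤ_[p]) A (X : PowerSeries ℤ_[p])) : A)) hNy
      simpa using h
    obtain ⟨j, hj⟩ := exists_C_pow_smul_eq_zero_of_nsmul_eq_zero (p := p) hN hNb
    refine ⟨j + k, ?_⟩
    rw [map_pow] at hj
    rw [pow_add, mul_smul]
    exact hj
  -- induction on the `X`-exponent
  have hall : ∀ (n : ℕ) (b : A), (X : PowerSeries ℤ_[p]) ^ n • b = 0 →
      ∃ j : ℕ, (C (p : ℤ_[p]) : PowerSeries ℤ_[p]) ^ j • b = 0 := by
    intro n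
    induction n with
    | zero =>
        intro b hb
        refine ⟨0, ?_⟩
        rw [pow_zero, one_smul] at hb ⊢
        exact hb
    | succ n ih =>
        intro b hb
        obtain ⟨i, hi⟩ := ih ((X : PowerSeries ℤ_[p]) • b) (by rwa [pow_succ, mul_smul] at hb)
        obtain ⟨j, hj⟩ := hX ((C (p : ℤ_[p]) : PowerSeries ℤ_[p]) ^ i • b)
          (by rw [smul_smul, mul_comm, ← smul_smul, hi])
        exact ⟨j + i, by rw [pow_add, mul_smul, hj]⟩
  obtain ⟨n, hn⟩ := htor a
  exact hall n a hn

/-- **`A₂[(p, X)]` is finite** from (fd₀): `A₂[𝔐] ⊆ {a ∈ A₂[X] | C p • a = 0}`, which `θ₀` maps to the finite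
`P[p]` with kernel inside the finite `ker θ₀`. [cite: Greenberg2006, §3 A (proof of Prop. 3.2, p. 359 L9–11)] -/
theorem finite_torsionBySet_maximalIdeal_of_fd {P : Type*} [AddCommGroup P] [Module ℤ_[p] P]
    (hPfin : Finite (Submodule.torsionBy ℤ_[p] P (p : ℤ_[p])))
    {A : Type*} [AddCommGroup A] [Module (PowerSeries ℤ_[p]) A]
    (θ₀ : Submodule.torsionBy (PowerSeries ℤ_[p]) A (X : PowerSeries ℤ_[p]) →+ P)
    (hθ : ∀ (c : ℤ_[p]) (a : Submodule.torsionBy (PowerSeries ℤ_[p]) A (X : PowerSeries ℤ_[p])),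
      θ₀ (C c • a) = c • θ₀ a)
    (hker : Finite θ₀.ker) :
    Finite (Submodule.torsionBySet (PowerSeries ℤ_[p]) A
      (maximalIdeal (PowerSeries ℤ_[p]) : Set (PowerSeries ℤ_[p]))) := by
  haveI := hker
  haveI := hPfin
  -- `T = A[X]` and its subgroup `S' = {a ∈ A[X] | C p • a = 0}`
  let T : Submodule (PowerSeries ℤ_[p]) A :=
    Submodule.torsionBy (PowerSeries ℤ_[p]) A (X : PowerSeries ℤ_[p])
  let S' : Submodule (PowerSeries ℤ_[p]) T :=
    Submodule.torsionBy (PowerSeries ℤ_[p]) T (C (p : ℤ_[p]) : PowerSeries ℤ_[p])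
  -- `θ₀` restricted to `S'` lands in `P[p]`
  have hland : ∀ s : S', (θ₀.comp S'.toAddSubgroup.subtype) s ∈
      Submodule.torsionBy ℤ_[p] P (p : ℤ_[p]) := by
    rintro ⟨s, hs⟩
    have hs' : (C (p : ℤ_[p]) : PowerSeries ℤ_[p]) • s = 0 := (Submodule.mem_torsionBy_iff _ _).mp hs
    rw [Submodule.mem_torsionBy_iff, AddMonoidHom.comp_apply]
    change (p : ℤ_[p]) • θ₀ s = 0
    rw [← hθ, hs', map_zero]
  -- its kernel embeds into `ker θ₀`, so `S'` is finite
  have hgker : Finite ((θ₀.comp S'.toAddSubgroup.subtype).codRestrict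
      (Submodule.torsionBy ℤ_[p] P (p : ℤ_[p])) hland).ker := by
    refine Finite.of_injective (fun z => (⟨((z : S') : T), ?_⟩ : θ₀.ker)) ?_
    · have hz := z.2
      rw [AddMonoidHom.mem_ker] at hz ⊢
      exact congrArg Subtype.val hz
    · intro z z' hzz'
      have h := congrArg Subtype.val hzz'
      exact Subtype.ext (Subtype.ext h)
  haveI : Finite S' := by
    letI : Fintype ((θ₀.comp S'.toAddSubgroup.subtype).codRestrict
      (Submodule.torsionBy ℤ_[p] P (p : ℤ_[p])) hland).ker := Fintype.ofFinite _
    letI : Fintype (Submodule.torsionBy ℤ_[p] P (p : ℤ_[p])) := Fintype.ofFinite _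
    letI : Fintype S' := AddGroup.fintypeOfKerOfCodom
      ((θ₀.comp S'.toAddSubgroup.subtype).codRestrict (Submodule.torsionBy ℤ_[p] P (p : ℤ_[p])) hland)
    exact Finite.of_fintype _
  -- `A[𝔐] ↪ S'`
  have hXmem : (X : PowerSeries ℤ_[p]) ∈ (maximalIdeal (PowerSeries ℤ_[p]) : Set (PowerSeries ℤ_[p])) :=
    powerSeries_X_mem_maximalIdeal
  have hpmem : (C (p : ℤ_[p]) : PowerSeries ℤ_[p]) ∈
      (maximalIdeal (PowerSeries ℤ_[p]) : Set (PowerSeries ℤ_[p])) :=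
    (powerSeries_mem_maximalIdeal_iff _).mpr (by
      rw [constantCoeff_C, PadicInt.maximalIdeal_eq_span_p]; exact Ideal.mem_span_singleton_self _)
  have hXa : ∀ a : Submodule.torsionBySet (PowerSeries ℤ_[p]) A
      (maximalIdeal (PowerSeries ℤ_[p]) : Set (PowerSeries ℤ_[p])), (a : A) ∈ T := fun a =>
    (Submodule.mem_torsionBy_iff _ _).mpr ((Submodule.mem_torsionBySet_iff _ _).mp a.2 ⟨X, hXmem⟩)
  have hpa : ∀ a : Submodule.torsionBySet (PowerSeries ℤ_[p]) A
      (maximalIdeal (PowerSeries ℤ_[p]) : Set (PowerSeries ℤ_[p])), (⟨(a : A), hXa a⟩ : T) ∈ S' :=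
    fun a => by
    rw [Submodule.mem_torsionBy_iff]
    apply Subtype.ext
    exact (Submodule.mem_torsionBySet_iff _ _).mp a.2 ⟨C (p : ℤ_[p]), hpmem⟩
  refine Finite.of_injective (fun a => (⟨⟨(a : A), hXa a⟩, hpa a⟩ : S')) fun a a' h => ?_
  have h1 := congrArg (fun s : S' => ((s : T) : A)) h
  exact Subtype.ext h1

/-- **`A₂` is a cofinitely generated `ℤ_p⟦X⟧`-module** from (tor) and the datum (fd₀) into a `p`-primary `P`
with `P[p]` finite (Greenberg's criterion over `ℤ_p⟦X⟧ ≃ ℤ_p⟦T₁⟧`).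
[cite: Greenberg2006, §3 A (Props. 3.1, 3.2, pp. 358–359)] -/
theorem isCofinitelyGenerated_of_fd {P : Type*} [AddCommGroup P] [Module ℤ_[p] P]
    (hP : ∀ y : P, ∃ k : ℕ, ((p : ℤ_[p]) ^ k) • y = 0)
    (hPfin : Finite (Submodule.torsionBy ℤ_[p] P (p : ℤ_[p])))
    {A : Type} [AddCommGroup A] [Module (PowerSeries ℤ_[p]) A]
    (htor : ∀ a : A, ∃ n : ℕ, (X : PowerSeries ℤ_[p]) ^ n • a = 0)
    (θ₀ : Submodule.torsionBy (PowerSeries ℤ_[p]) A (X : PowerSeries ℤ_[p]) →+ P)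
    (hθ : ∀ (c : ℤ_[p]) (a : Submodule.torsionBy (PowerSeries ℤ_[p]) A (X : PowerSeries ℤ_[p])),
      θ₀ (C c • a) = c • θ₀ a)
    (hker : Finite θ₀.ker) :
    IsCofinitelyGenerated (PowerSeries ℤ_[p]) A := by
  haveI := finite_torsionBySet_maximalIdeal_of_fd hPfin θ₀ hθ hker
  refine isCofinitelyGenerated_of_finite_torsionBy_maximalIdeal
    (MvPowerSeries.renameEquiv ℤ_[p] (finOneEquiv.symm : Unit ≃ Fin 1)).toRingEquiv fun a => ?_
  obtain ⟨j, hj⟩ := exists_C_pow_smul_eq_zero_of_fd hP htor θ₀ hθ hker a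
  obtain ⟨n, hn⟩ := htor a
  exact ⟨j + n, iwasawaAlgebra_maximalIdeal_pow_smul_eq_zero a hj hn⟩

/-- **The displayed input `hD` of conjunct (fg) of `stub_weightTwoControl`** (telescope v9, leaf N2), from the
leaf's clause (tor) and an (fd₀)-type datum into a `p`-primary `ℤ_p`-module `P` with `P[p]` finite: the big
module `A₂ ⊗ B^*(Ψ⁻¹) = BigRepModule ℤ_p⟦X⟧ p A₂` is a cofinitely generated `B = ℤ_p⟦X⟧⟦T⟧`-module. Feed it to
`TelescopeK2BigRepUnramified.module_finite_XBig_twoVar_of_isUnramifiedOutside` (p748872). Closes nothing by itself.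
[cite: Greenberg2006, §4 p. 367 L33–39 ("a discrete, cofinitely generated Λ-module 𝒟")] [cite: Greenberg2016Selmer, §1 p. 4 L11–13] -/
theorem isCofinitelyGenerated_bigRepModule_twoVar_of_fd {P : Type*} [AddCommGroup P] [Module ℤ_[p] P]
    (hP : ∀ y : P, ∃ k : ℕ, ((p : ℤ_[p]) ^ k) • y = 0)
    (hPfin : Finite (Submodule.torsionBy ℤ_[p] P (p : ℤ_[p])))
    {A₂ : Type} [AddCommGroup A₂] [Module (PowerSeries ℤ_[p]) A₂]
    (htor : ∀ a : A₂, ∃ n : ℕ, (X : PowerSeries ℤ_[p]) ^ n • a = 0)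
    (θ₀ : Submodule.torsionBy (PowerSeries ℤ_[p]) A₂ (X : PowerSeries ℤ_[p]) →+ P)
    (hθ : ∀ (c : ℤ_[p]) (a : Submodule.torsionBy (PowerSeries ℤ_[p]) A₂ (X : PowerSeries ℤ_[p])),
      θ₀ (C c • a) = c • θ₀ a)
    (hker : Finite θ₀.ker) :
    IsCofinitelyGenerated (PowerSeries (PowerSeries ℤ_[p])) (BigRepModule (PowerSeries ℤ_[p]) p A₂) :=
  isCofinitelyGenerated_bigRepModule_of_isCofinitelyGenerated
    (MvPowerSeries.renameEquiv ℤ_[p] (finOneEquiv.symm : Unit ≃ Fin 1)).toRingEquiv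
    (Classical.choice (nonempty_iwasawaAlgebraTwoVar_ringEquiv_mvPowerSeries p))
    (isCofinitelyGenerated_of_fd hP hPfin htor θ₀ hθ hker)

/-- `E[p^∞] = PrimaryTorsion E.geomPoints p` is `p`-primary as a `ℤ_p`-module.
[cite: Serre1968, Ch. I §1.2 (`E_{ℓ^∞} = ⋃ E_{ℓⁿ}`)] -/
theorem primaryTorsion_exists_pow_smul_eq_zero {G : Type*} [AddCommGroup G] (y : PrimaryTorsion G p) :
    ∃ k : ℕ, ((p : ℤ_[p]) ^ k) • y = 0 :=
  ⟨y.level, PrimaryTorsion.pow_smul_eq_zero_of y y.level_spec⟩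

/-- `E[p^∞][p] ↪ E[p]`, so `E[p^∞][p]` is finite for an elliptic curve over a field of characteristic `≠ p`
(`#E[p] = p²`). [cite: SilvermanAEC2009, Cor. III.6.4(b)] -/
theorem finite_torsionBy_primaryTorsion_geomPoints {F : Type} [Field F] (E : WeierstrassCurve F)
    [E.IsElliptic] (hpF : (p : F) ≠ 0) :
    Finite (Submodule.torsionBy ℤ_[p] (PrimaryTorsion E.geomPoints p) (p : ℤ_[p])) := by
  have hp : p.Prime := Fact.out
  have hpK : ((p : ℕ) : AlgebraicClosure F) ≠ 0 := by
    rw [← map_natCast (algebraMap F (AlgebraicClosure F)) p]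
    exact (map_ne_zero_iff _ (algebraMap F (AlgebraicClosure F)).injective).mpr hpF
  have hcard : Nat.card (E.geomTorsion (p : ℤ)) = p ^ 2 :=
    WeierstrassCurve.card_torsionBy_eq_sq (E := E.baseChange (AlgebraicClosure F)) hpK
  haveI : Finite (E.geomTorsion (p : ℤ)) :=
    Nat.finite_of_card_ne_zero (by rw [hcard]; exact pow_ne_zero 2 hp.ne_zero)
  have hmem : ∀ y : Submodule.torsionBy ℤ_[p] (PrimaryTorsion E.geomPoints p) (p : ℤ_[p]),
      ((y : PrimaryTorsion E.geomPoints p) : E.geomPoints) ∈ E.geomTorsion (p : ℤ) := fun y => by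
    have hy : (p : ℤ_[p]) • (y : PrimaryTorsion E.geomPoints p) = 0 :=
      (Submodule.mem_torsionBy_iff _ _).mp y.2
    rw [PrimaryTorsion.natCast_smul] at hy
    have hval : p • ((y : PrimaryTorsion E.geomPoints p) : E.geomPoints) = 0 := by
      rw [← PrimaryTorsion.val_nsmul, hy, PrimaryTorsion.val_zero]
    exact (Submodule.mem_torsionBy_iff (R := ℤ) _ _).mpr (by rw [natCast_zsmul]; exact hval)
  refine Finite.of_injective
    (fun y : Submodule.torsionBy ℤ_[p] (PrimaryTorsion E.geomPoints p) (p : ℤ_[p]) =>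
      (⟨((y : PrimaryTorsion E.geomPoints p) : E.geomPoints), hmem y⟩ : E.geomTorsion (p : ℤ)))
    fun y y' h => ?_
  have h1 := congrArg Subtype.val h
  exact Subtype.ext (PrimaryTorsion.ext h1)

/-- **`hD` for the leaf as typed**: with `P = E[p^∞] = PrimaryTorsion E.geomPoints p` (`E = W.baseChange K` in
`stub_weightTwoControl`, `char K = 0`), conjunct (tor) and the clauses `θ₀(C c • a) = c • θ₀ a`, `Finite θ₀.ker`
of (fd₀) give the cofinite generation of `BigRepModule ℤ_p⟦X⟧ p A₂` over `ℤ_p⟦X⟧⟦T⟧`. Closes nothing by itself.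
[cite: Greenberg2006, §4 p. 367 L33–39] [cite: SilvermanAEC2009, Cor. III.6.4(b)] -/
theorem isCofinitelyGenerated_bigRepModule_twoVar_of_fd_primaryTorsion {F : Type} [Field F]
    (E : WeierstrassCurve F) [E.IsElliptic] (hpF : (p : F) ≠ 0)
    {A₂ : Type} [AddCommGroup A₂] [Module (PowerSeries ℤ_[p]) A₂]
    (htor : ∀ a : A₂, ∃ n : ℕ, (X : PowerSeries ℤ_[p]) ^ n • a = 0)
    (θ₀ : Submodule.torsionBy (PowerSeries ℤ_[p]) A₂ (X : PowerSeries ℤ_[p]) →+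
      PrimaryTorsion E.geomPoints p)
    (hθ : ∀ (c : ℤ_[p]) (a : Submodule.torsionBy (PowerSeries ℤ_[p]) A₂ (X : PowerSeries ℤ_[p])),
      θ₀ (C c • a) = c • θ₀ a)
    (hker : Finite θ₀.ker) :
    IsCofinitelyGenerated (PowerSeries (PowerSeries ℤ_[p])) (BigRepModule (PowerSeries ℤ_[p]) p A₂) :=
  isCofinitelyGenerated_bigRepModule_twoVar_of_fd primaryTorsion_exists_pow_smul_eq_zero
    (finite_torsionBy_primaryTorsion_geomPoints E hpF) htor θ₀ hθ hker

end K2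

end Summit.BirchSwinnertonDyer.BirchSwinnertonDyer.Theorems.TelescopeK2FibreCofinite
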